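import Literature.Claims.NS.Prastaro2015
import HarnessLib

/-!
# Salvage C29 `Prastaro2015` — the TRUE typed steps: constant solutions (Step 1) and Lemma A1 (Step 2)

Cell ns-claims (D-0090), salvage seat ns-claims-salvage-p1 (g2). In the typed skeleton
`Literature.Claims.NS.Prastaro2015` (A. Prástaro, arXiv:1503.07851 v4) the two steps preceding the
load-bearing gluing/regularisation step (Lemma A2 / (A.6), refuter lane `….Theorems.Prastaro2015.not_Step4_concrete`)
are elementary and TRUE:

* `Step1_ConstantSolutions` — Example 4.5 (66) p. 28: a constant section `(v₀, p₀, θ₀)` solves the system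
  iff the body force is equipotential on all of space, `∇f ≡ 0` (every derivative of a constant vanishes,
  so (A), (D) hold identically and (C) reduces to `ρ ∇f = 0`, `ρ > 0`);
* `Step2_LemmaA1` — Lemma A1 p. 32, constructive core («we can assume that s₀ does not coincide with s.
  Otherwise we could take a different constant value from s»): near any point there is a local smooth
  solution differing from the given constant one — the constant section with pressure `p₀ + 1`.

Main: `step1_holds : Step1_ConstantSolutions`, `step2_holds : Step2_LemmaA1` (pure calculus; claim
vocabulary, no consumer outside C29 — recorded so that the cell's record «Steps 1–2 true, Step 3 abstract,
Step 4 false» is a kernel statement at Steps 1, 2, 4).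

WHAT THIS IS NOT: not a claim about NS regularity or blow-up; not a claim about any author beyond the typed
locator.
-/

noncomputable section

open Set Function Filter Topology
open scoped ContDiff Laplacian InnerProductSpace

set_option linter.dupNamespace false

namespace Summit.NavierStokesRegularity.NavierStokesRegularity.Theorems.Prastaro2015

open Literature.Claims.NS.Prastaro2015 Literature.Analysis.FluidPDE

/-- The Laplacian of a constant function vanishes. [folklore] -/
private theorem laplacian_const_eq_zero {F : Type*} [NormedAddCommGroup F] [NormedSpace ℝ F]
    (c : F) (x : E3) : (Δ (fun _ : E3 => c)) x = 0 := by
  rw [InnerProductSpace.laplacian_eq_iteratedFDeriv_orthonormalBasis _ (stdOrthonormalBasis ℝ E3)]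
  simp [iteratedFDeriv_const_of_ne (𝕜 := ℝ) two_ne_zero c]

/-- **(A), (C), (D) at a constant section**: the constant section `(v₀, p₀, θ₀)` is a global smooth
solution as soon as `∇f ≡ 0`. [cite: Prastaro2015Maslov, Example 4.5 (66) p. 28] -/
theorem isGlobalSolution_const {m : Medium} (v₀ : E3) (p₀ θ₀ : ℝ) (hf : ∀ x, gradient m.f x = 0) :
    IsGlobalSolution m (WSection.const v₀ p₀ θ₀) where
  isOpen := isOpen_univ
  smooth_v := contDiffOn_const
  smooth_p := contDiffOn_const
  smooth_θ := contDiffOn_const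
  eqA q _ := by
    simp only [EqA, WSection.const]
    simp [VectorCalculus.divergence]
  eqC q _ := by
    simp only [EqC, WSection.const]
    rw [laplacian_const_eq_zero, hf]
    simp [convect]
  eqD q _ := by
    simp only [EqD, WSection.const]
    rw [laplacian_const_eq_zero]
    simp [frobeniusNormSq_zero]

/-- Conversely, a constant global solution forces `∇f ≡ 0` (equation (C) at `(0, x)`: `ρ ∇f(x) = 0`,
`ρ > 0`). [cite: Prastaro2015Maslov, Example 4.5 (66) p. 28] -/
theorem gradient_f_eq_zero_of_const_solution {m : Medium} {v₀ : E3} {p₀ θ₀ : ℝ}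
    (h : IsGlobalSolution m (WSection.const v₀ p₀ θ₀)) (x : E3) : gradient m.f x = 0 := by
  have hC := h.eqC (0, x) (mem_univ _)
  simp only [EqC, WSection.const] at hC
  rw [laplacian_const_eq_zero] at hC
  have h' : m.ρ = 0 ∨ gradient m.f x = 0 := by simpa [convect] using hC
  exact h'.resolve_left m.ρ_pos.ne'

/-- **Step 1 holds** — Example 4.5 (66) p. 28: «such constant solutions exist iff they are localized in a
equipotential space-region», globally: iff `∇f ≡ 0`. [cite: Prastaro2015Maslov, Example 4.5 (66) p. 28] -/
theorem step1_holds : Step1_ConstantSolutions := fun _ v₀ p₀ θ₀ =>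
  ⟨fun h x => gradient_f_eq_zero_of_const_solution h x, fun hf => isGlobalSolution_const v₀ p₀ θ₀ hf⟩

/-- **Step 2 holds** — Lemma A1 p. 32, constructive core: near every space-time point a constant global
solution `s` admits a local smooth solution `s₀ ≠ s` — the constant section with pressure shifted by `1`
(a global solution by Step 1, restricted to the ball). [cite: Prastaro2015Maslov, Lemma A1 p. 32] -/
theorem step2_holds : Step2_LemmaA1 := by
  intro m s hs hsol q₀ δ hδ
  obtain ⟨v₀, p₀, θ₀, rfl⟩ := hs
  have hf : ∀ x, gradient m.f x = 0 := gradient_f_eq_zero_of_const_solution hsol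
  refine ⟨Metric.ball q₀ δ, WSection.const v₀ (p₀ + 1) θ₀, Metric.isOpen_ball, Metric.mem_ball_self hδ,
    Subset.rfl, IsSolutionOn.of_global (isGlobalSolution_const v₀ (p₀ + 1) θ₀ hf) Metric.isOpen_ball, q₀,
    Metric.mem_ball_self hδ, ?_⟩
  simp [WSection.eval_const]

end Summit.NavierStokesRegularity.NavierStokesRegularity.Theorems.Prastaro2015

end

-- WHAT THIS IS NOT: not a claim about NS regularity or blow-up; not a claim about any author beyond the typed locator.
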